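import Summits.QuantumFields.YangMills.Theorems.BalabanUVNodesK0AxJunctionRootGrad
import Literature.MathematicalPhysics.QuantumFieldTheory.Balaban1983to89.B11Eq177CriticalFamilyDerivative

/-!
# NODE O · K0ᴬ — THE TANGENT SOCKET: dag-n12-w3's SELECTION-FREE DERIVATIVE MACHINE ⟹ weak criticality of the CHART response, modulo two FLAT dictionaries
# (FILE 4 of the «rooting is a gradient at first order» cut; consumes FILE 2 `…K0AxJunctionRootGrad` = `chartRespD`, `ChartResponseWeaklyCriticalAt`, and the N12 machine by name)

LANDING NOTE (porter ▶ PTC-1 g4, 2026-08-31; AUTHORSHIP = ◇ lens-1 g11 «cauchy-analytic», HOME sketch `nodeO-cover/LENS-1g11-TangentSocket-v1.lean` sha16 8a2b1113e05dc991 · 254 l. · 4 def + 5 thm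
· 0 sorry (body checked by the author inside `…-v2scratch.lean` 83de3f1318fbc381)): landed VERBATIM (only this paragraph added) under the basename ◇ lens-1 proposed
(`…Theorems/BalabanUVNodesK0AxTangentSocket.lean`) as INTENT-56, after ✓p821443 `…K0AxJunctionRootGrad` (FILE 54); `--supports stmt-QuantumFields-27238 --as helper` (NO `--workitem`; kind
definition by the `def` rule); ◆ CRIT-1 g37's cut: «CANDIDATE 2 (TANGENT SOCKET) — SAME-WALL VERDICT: SURVIVES (PRICED); CUT: ONE FILE 56 AS IS; J1′ ∕ J4 ∕ J5′ ∕ (Q-ord) ∕ (Q-bridge): PASS; price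
(L6) displayed = {family token `FlatCriticalExpChartFamilyAt`, (J-crit′) `FlatCritDictionary`, (J-cons′) `FlatConsDictionary`, (s-exp)} inhabited NOWHERE; axioms standard on ◆'s run» (nodeO STATUS
2026-08-31T11:21:59Z).  HEADER SENTENCE ◆ ASKED FOR (self-correcting the tree's prose): INSTANCE CONDITION = (rng) + (min) + (s-exp) — fibre membership and fibre-criticality of the chart members
plus the chart identification `S.chartCfg ∘ unitField =ᶠ expChart 1 ∘ X` near 0; the (21)-Landau-gauge slice is NOT required (◆ CRIT-1 g37, nodeO STATUS 11:21:59Z, CORRECTING ◆'s own 11:13:06Z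
instance condition that the landing paragraphs of ✓`…K0AxRootGradCalc` ∕ ✓`…K0AxJunctionRootGrad` ∕ ✓`…K0AxJunctionRootGradScheme` quote — by ✓`weaklyCritical_add_dE`, `WeaklyCritical` is
invariant under RESTRICTED gradients `dE c n`, `n ∈ ker (QpE D)`, and a residual re-gauging of a fibre-critical chart member shifts the response by exactly such a gradient; the (C-tab-opt) wall is
made of UNRESTRICTED gradients).  HONEST (porter): pure logic ∕ calculus; CONDITIONAL theorems over DISPLAYED letters ((f), (J-crit′), (J-cons′), (s-exp), KNIT tokens — all OPEN, inhabited
NOWHERE); (C-tab-opt) stays STRUCK; nothing of Bałaban asserted, ported, discharged or refuted; K0ᴬ stmt-QuantumFields-27238 ∕ K0⁷ 20541 OPEN — NOTHING of them proved; NODE O 0∕1; COUNT 8∕28 · K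
1∕4 UNMOVED; finite 𝕋⁴ at fixed ε — NOT continuum ∕ OS ∕ Clay; the Yang–Mills mass gap is NOT proved by any of this.

◇ `ymgap-nodeO-lens-1` g11 (planner; typed for the porter ▶ PTC-1; proposed basename `…/Theorems/BalabanUVNodesK0AxTangentSocket.lean`,
`--supports stmt-QuantumFields-27238 --as helper`).  Items: K0ᴬ stmt-QuantumFields-27238 OPEN; K0⁷ stmt-QuantumFields-20541 OPEN.  [15] = [Balaban1985Variational],
[I] = [Balaban1987RG1], [B6] = [Balaban1984PropagatorsII], [LF-II] = [Balaban1989LargeFieldII].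

WHY.  FILES 1–3 (`…K0AxRootGradCalc`, `…K0AxJunctionRootGrad`, `…K0AxJunctionRootGradScheme`) move the (R-a) receipts (C-wcg) ∕ (C-orb) ∕ (C-crit) ∕ (C-cons) and TokP9reg♭ᵣ of
✓`K0AxJoinT.twoVolExp_orbit_images` off the selector: under the factorisation letter they follow from ONE chart-level letter, `ChartResponseWeaklyCriticalAt U a l` — every
`ξ⁻¹`·re∕im ENTRY of the chart response is weakly critical (`QE = ρ₈`-datum ∧ `⟪dcE 1 ·, dcE 1 w⟫ = 0` on `ker Q`; ✓`K0AxCtabUniq.WeaklyCritical`, no gauge condition).  Print's reason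
((176)–(178): «the expansion of 𝓗 begins with H₁B»; [B6] (2.35)) is a statement about the derivative of a family of constrained critical configurations, and the tree HOLDS the
selection-free machine for exactly that (dag-n12-w3 ✓`B11Eq177CriticalFamilyDerivative`: `lagrangeHessian_fderiv_apply_eq_zero` — ANY differentiable family of tangent-critical
members has `q`-orthogonal velocity on `ker DΦ`; `hasFDerivAt_constraint_comp`; at the flat background `λ₀ = 0` by `fderiv_wilsonAction4_expChart_one_eq_zero`).  This file is the
SOCKET between the two currencies: NO nondegeneracy, NO `H₁`, NO gauge slice is needed for weak criticality — only (i) flat tangent-criticality + the linearised fibre condition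
(N12, PROVED here for any exp-chart family `B ↦ expChart 1 (X B)` from the displayed family token), and (ii) two FINITE FLAT DICTIONARIES between DEF-1's K0 letters
(`QE (univDomains)`, `dcE 1`, `reBond ∕ imBond`, `windowSrc`, `ρ₈`, `ξ = η(k+1)`) and Node00's (`DΨ(0)`, `D²(A∘expChart 1)(0)` on `𝔰𝔲(2)`-fields) — DISPLAYED, named
(J-crit′) `FlatCritDictionary` and (J-cons′) `FlatConsDictionary`; their Node00 halves are in the tree (✓`Node00.LinearisedAveragingFlat.qLin_one_eq_family`,
✓`…N12GuardedChartDerivQLinJunction`, ✓`hessian_wilsonAction4_flat_eq_secondVariation`).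

WHAT IS PROVED (kernel, sorry-free, standard axioms; namespace `K0AxCtabUniq`).
* `respDir`, `chartRespD_eq_fderiv_respDir` (bookkeeping: the response direction `δ_l ⊗ bV a`).
* ★★ `chartResponseWeaklyCritical_of_tangentData` — THE ABSTRACT SOCKET (pure logic, any tangent space `X`, any `L`, `a₂`, `Dd`): entries read off tangent data + flat
  tangent-criticality `a₂ (Y₀ v) t = 0 (t ∈ ker L)` + linearised fibre condition `L (Y₀ v) = Dd v` + (J-crit′) + (J-cons′) ⟹ `ChartResponseWeaklyCriticalAt`.
* ★ `hasFDerivAt_coe_expChart_one` — `D(expChart 1)(0)` = the inclusion `𝔰𝔲(N)^{bonds} ↪ matrices^{bonds}` (Fréchet form of ✓`Node00.hasDerivAt_coe_expChart_along`).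
* ★★ `flatCritical_tangentData` — THE NODE00 PLUG (generic parameter space `G`): for a family `X : G → 𝔰𝔲(2)^{bonds}` through `0`, differentiable at `0`, members tangent-critical
  near `0` for a `C²` constraint chart `Ψ` with onto `DΨ(0)`, lying on the fibres `Ψ (X g) = datum g`: (i) `D²(A∘expChart 1)(0)(X′h, t) = 0` for `t ∈ ker DΨ(0)` (N12 +
  `λ₀ = 0`), (ii) `DΨ(0)(X′h) = D datum(0) h`, (iii) the ENTRY derivative of `g ↦ expChart 1 (X g)` at `0` is the entry array of `X′h`.
* displayed letters `FlatCriticalExpChartFamilyAt` (the family token, K0 parameter space), `FlatCritDictionary` (J-crit′), `FlatConsDictionary` (J-cons′).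
* ★★★ `chartResponseWeaklyCritical_of_flatCriticalExpChartFamily` — THE SOCKET, PLUGGED: family token + (J-crit′) + (J-cons′) ⟹ `ChartResponseWeaklyCriticalAt F θ k K (B ↦ expChart 1
  (X B)) a l` for all `a l`; with FILE 2's `rootedReceipts_of_chart` (factorisation letter `recordBgField =ᶠ rootGauge (k+1) ∘ expChart 1 ∘ X` + chart regularity) the four (R-a)
  receipts of the ROOTED table follow.

HONEST.  Calculus + logic; CONDITIONAL theorems over DISPLAYED letters (the family token's criticality ∕ fibre ∕ onto clauses = [15] Thm 1 + (82)–(83) + n07-e's submersion letter AT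
FLAT; the two dictionaries = finite normalisation identities, UNDECIDED here); nothing of Bałaban ([15] Thm 1, Prop. 6–9, (176)–(178); [B6] (2.35); [LF-II] (1.12); [I] (4.35)) is
asserted, ported or discharged; (C-tab-opt) stays STRUCK; K0ᴬ 27238 ∕ K0⁷ 20541 OPEN — NOTHING of them proved; NODE O 0∕1; COUNT 8∕28 · K 1∕4 UNMOVED; finite 𝕋⁴_{L^K} at fixed ε —
NOT continuum ∕ OS ∕ Clay; **the Yang–Mills mass gap is NOT proved by any of this.**  No `sorry`, no `instance ∕ notation ∕ set_option`; standard axioms.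
-/

noncomputable section

open Filter Topology
open scoped BigOperators Matrix.Norms.L2Operator

namespace Summit.QuantumFields.YangMills.Theorems.K0AxCtabUniq

open Literature.MathematicalPhysics.QuantumFieldTheory.Balaban1983to89
open LatticeFieldCalculus B6SectADomainsV1 B6SectAOperatorsV1 B6SectAVectorModelV1 B6SectACriticalPointV1
open Literature.MathematicalPhysics.QuantumFieldTheory.Balaban1983to89.T4Continuum (T4Family)
open Literature.MathematicalPhysics.QuantumFieldTheory.Balaban1983to89.Node00
open T4RootedResidualGauge (rootGauge)
open GaugeField (gaugeAct)
open B12GaugeOrbits021 (IsResidual OrbitRel)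
open B11Prop6Scheme (mapT)
open Summit.QuantumFields.YangMills.Theorems.K0RecordFormatNames
open Summit.QuantumFields.YangMills.Theorems.K0AxRootGrad

variable (F : T4Family) (θ : Stage13Params F 2)

/-! ## §4  The TANGENT SOCKET: N12's selection-free derivative machine ⟹ chart weak criticality, modulo two FLAT dictionaries -/

section TangentSocket

open Literature.MathematicalPhysics.QuantumFieldTheory.Balaban1983to89.B11Eq177CriticalFamilyDerivative
open T4AdjointCovarianceUnitary (lieSU expSU coe_expSU)
open scoped InnerProductSpace
open Literature.MathematicalPhysics.QuantumFieldTheory.BalabanImbrieJaffe1984to88.BIJ85AxialPropagator411 (BondSpace)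

/-- The response DIRECTION `δ_l ⊗ bV a` of ✓`recordD` ∕ `chartRespD` (the `B`-space vector differentiated along). [cite: Balaban1987RG1, (4.35) p.290 (bookkeeping)] -/
def respDir (k K : ℕ) (a : θ.ιβ) (l : RespLabel F k K) : Fin (F.P K).d → Site (F.P K) (k + 1) → θ.Vβ :=
  letI := θ.instVβ₁; letI := θ.instVβ₂; letI := θ.instιβ
  Pi.single l.1 (Pi.single l.2 (θ.bV a))

/-- `chartRespD` is the `B`-derivative of the chart entries at `0` in the direction `respDir a l`. [cite: Balaban1987RG1, (4.35) p.290 (bookkeeping)] -/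
theorem chartRespD_eq_fderiv_respDir (k K : ℕ) (U : (Fin (F.P K).d → Site (F.P K) (k + 1) → θ.Vβ) → GaugeField (F.P K) 0 (SU 2))
    (a : θ.ιβ) (l : RespLabel F k K) (b : PBond (F.P K) 0) (i i' : Fin 2) :
    chartRespD F θ k K U a l b i i' =
      (letI := θ.instVβ₁; letI := θ.instVβ₂
       fderiv ℝ (fun B : Fin (F.P K).d → Site (F.P K) (k + 1) → θ.Vβ =>
         fun (b : PBond (F.P K) 0) (i i' : Fin 2) => ((U B b : SU 2) : Matrix (Fin 2) (Fin 2) ℂ) i i') 0 (respDir F θ k K a l) b i i') := rfl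

/-- ★★ **THE ABSTRACT TANGENT SOCKET** (entry level; pure logic): if the chart's response entries are read off TANGENT DATA `Y₀ v ∈ X` through an entry map `ent`, the tangent
data are FLAT-TANGENT-CRITICAL (`a₂ (Y₀ v) t = 0` for `t ∈ ker L` — N12's `lagrangeHessian_fderiv_apply_eq_zero` with `λ₀ = 0`) and satisfy the LINEARISED FIBRE CONDITION
(`L (Y₀ v) = Dd v` — N12's `hasFDerivAt_constraint_comp`), then the two displayed FLAT DICTIONARIES — (J-crit′) every K0 test pairing `⟪dcE 1 (ξ⁻¹·re∕im entry ·), dcE 1 w⟫`,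
`w ∈ ker Q`, is `a₂(·, t)` for some `t ∈ ker L`; (J-cons′) a tangent vector with the datum's linearised average has K0-constraint `ρ₈`-datum entry by entry — give
`ChartResponseWeaklyCriticalAt`.  No nondegeneracy, no `H₁`, no gauge condition. [cite: Balaban1985Variational, (176)–(178) p.306, (36)–(37) p.283, (82)–(83) p.290; Balaban1984PropagatorsII, (2.35) p.228] -/
theorem chartResponseWeaklyCritical_of_tangentData (k K : ℕ)
    (U : (Fin (F.P K).d → Site (F.P K) (k + 1) → θ.Vβ) → GaugeField (F.P K) 0 (SU 2))
    {X V' : Type*} [NormedAddCommGroup X] [NormedSpace ℝ X] [NormedAddCommGroup V'] [NormedSpace ℝ V']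
    (ent : X → PBond (F.P K) 0 → Fin 2 → Fin 2 → ℂ) (Y₀ : (Fin (F.P K).d → Site (F.P K) (k + 1) → θ.Vβ) → X)
    (hent : ∀ (a : θ.ιβ) (l : RespLabel F k K) (b : PBond (F.P K) 0) (i i' : Fin 2),
      chartRespD F θ k K U a l b i i' = ent (Y₀ (respDir F θ k K a l)) b i i')
    (L : X →L[ℝ] V') (a₂ : X →L[ℝ] X →L[ℝ] ℝ) (Dd : (Fin (F.P K).d → Site (F.P K) (k + 1) → θ.Vβ) → V')
    (hcrit : ∀ v t, L t = 0 → a₂ (Y₀ v) t = 0) (hcons : ∀ v, L (Y₀ v) = Dd v)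
    (Jcrit : ∀ hk : k + 1 ≤ (F.P K).m + (F.P K).K, ∀ (i i' : Fin 2) (w : BondSpace (F.P K)), QE (univDomains F k K hk) w = 0 →
      (∃ t, L t = 0 ∧ ∀ Y, ⟪dcE 1 (reBond F K fun b => (((F.P K).eta (k + 1))⁻¹ : ℂ) * ent Y b i i'), dcE 1 w⟫_ℝ = a₂ Y t) ∧
      (∃ t, L t = 0 ∧ ∀ Y, ⟪dcE 1 (imBond F K fun b => (((F.P K).eta (k + 1))⁻¹ : ℂ) * ent Y b i i'), dcE 1 w⟫_ℝ = a₂ Y t))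
    (Jcons : ∀ hk : k + 1 ≤ (F.P K).m + (F.P K).K, ∀ (a : θ.ιβ) (l : RespLabel F k K) (i i' : Fin 2) (Y : X),
      L Y = Dd (respDir F θ k K a l) →
      QE (univDomains F k K hk) (reBond F K fun b => (((F.P K).eta (k + 1))⁻¹ : ℂ) * ent Y b i i') =
          (θ.ρ8 (θ.bV a) i i').re • windowSrc F k K hk Finset.univ l ∧
        QE (univDomains F k K hk) (imBond F K fun b => (((F.P K).eta (k + 1))⁻¹ : ℂ) * ent Y b i i') =
          (θ.ρ8 (θ.bV a) i i').im • windowSrc F k K hk Finset.univ l)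
    (a : θ.ιβ) (l : RespLabel F k K) : ChartResponseWeaklyCriticalAt F θ k K U a l := by
  letI := θ.instVβ₁; letI := θ.instVβ₂
  intro hk i i'
  have hre : (reBond F K fun b => (((F.P K).eta (k + 1))⁻¹ : ℂ) * chartRespD F θ k K U a l b i i') =
      reBond F K fun b => (((F.P K).eta (k + 1))⁻¹ : ℂ) * ent (Y₀ (respDir F θ k K a l)) b i i' := by
    congr 1; funext b; rw [hent]
  have him : (imBond F K fun b => (((F.P K).eta (k + 1))⁻¹ : ℂ) * chartRespD F θ k K U a l b i i') =
      imBond F K fun b => (((F.P K).eta (k + 1))⁻¹ : ℂ) * ent (Y₀ (respDir F θ k K a l)) b i i' := by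
    congr 1; funext b; rw [hent]
  obtain ⟨hc1, hc2⟩ := Jcons hk a l i i' (Y₀ (respDir F θ k K a l)) (hcons _)
  rw [hre, him]
  refine ⟨⟨hc1, fun w hw => ?_⟩, ⟨hc2, fun w hw => ?_⟩⟩
  · obtain ⟨⟨t, ht, hY⟩, -⟩ := Jcrit hk i i' w hw
    rw [hY]; exact hcrit _ t ht
  · obtain ⟨-, ⟨t, ht, hY⟩⟩ := Jcrit hk i i' w hw
    rw [hY]; exact hcrit _ t ht

/-- ★ **`D(expChart 1)(0) = ` the inclusion `𝔰𝔲(N)^{bonds} ↪ (N×N matrices)^{bonds}`** (Fréchet form of ✓`Node00.hasDerivAt_coe_expChart_along`; `D exp(0) = id`, Mathlib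
`hasStrictFDerivAt_exp_zero`). [cite: Balaban1985RegularSpaces, (1.10) p.77 (bookkeeping: first order of `exp`)] -/
theorem hasFDerivAt_coe_expChart_one {P : Params} {j N : ℕ} [NeZero N] :
    HasFDerivAt (fun Y : PBond P j → lieSU (Fin N) =>
        fun b : PBond P j => ((expChart (1 : GaugeField P j (SU N)) Y b : SU N) : Matrix (Fin N) (Fin N) ℂ))
      (ContinuousLinearMap.pi fun b : PBond P j => (lieSU (Fin N)).subtypeL.comp (ContinuousLinearMap.proj b)) 0 := by
  refine hasFDerivAt_pi.2 fun b => ?_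
  obtain ⟨Lb, hLb⟩ : ∃ Lb : (PBond P j → lieSU (Fin N)) →L[ℝ] Matrix (Fin N) (Fin N) ℂ,
      ∀ Y, Lb Y = ((Y b : lieSU (Fin N)) : Matrix (Fin N) (Fin N) ℂ) :=
    ⟨(lieSU (Fin N)).subtypeL.comp (ContinuousLinearMap.proj b), fun Y => rfl⟩
  have hexp : HasFDerivAt (NormedSpace.exp : Matrix (Fin N) (Fin N) ℂ → Matrix (Fin N) (Fin N) ℂ)
      ((1 : Matrix (Fin N) (Fin N) ℂ →L[ℂ] Matrix (Fin N) (Fin N) ℂ).restrictScalars ℝ) (Lb 0) := by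
    rw [map_zero]
    exact ((hasStrictFDerivAt_exp_zero (𝕂 := ℂ) (𝔸 := Matrix (Fin N) (Fin N) ℂ)).hasFDerivAt).restrictScalars ℝ
  have hc : HasFDerivAt (fun Y : PBond P j → lieSU (Fin N) => NormedSpace.exp (Lb Y))
      (((1 : Matrix (Fin N) (Fin N) ℂ →L[ℂ] Matrix (Fin N) (Fin N) ℂ).restrictScalars ℝ).comp Lb) 0 := hexp.comp 0 Lb.hasFDerivAt
  have hfun : (fun Y : PBond P j → lieSU (Fin N) => ((expChart (1 : GaugeField P j (SU N)) Y b : SU N) : Matrix (Fin N) (Fin N) ℂ))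
      = fun Y => NormedSpace.exp (Lb Y) := by
    funext Y
    rw [coe_expChart, hLb]
    have h1 : (((1 : GaugeField P j (SU N)) b : SU N) : Matrix (Fin N) (Fin N) ℂ) = 1 := by
      show (((1 : SU N)) : Matrix (Fin N) (Fin N) ℂ) = 1
      simp
    rw [h1, one_mul]
  show HasFDerivAt (fun Y : PBond P j → lieSU (Fin N) => ((expChart (1 : GaugeField P j (SU N)) Y b : SU N) : Matrix (Fin N) (Fin N) ℂ)) _ 0
  rw [hfun]
  refine hc.congr_fderiv (ContinuousLinearMap.ext fun Y => ?_)
  rw [ContinuousLinearMap.comp_apply, ContinuousLinearMap.coe_restrictScalars', hLb]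
  rfl

/-- ★★ **THE NODE00 PLUG: flat tangent data of an exp-chart family** — for ANY family `g ↦ X g` of Lie-algebra fields through `0`, differentiable at `0`, whose members are
tangent-critical on their fibres near `0` for a `C²` constraint chart `Ψ` with onto `DΨ(0)` and which lies on the fibres `Ψ (X g) = datum g` near `0`: (i) `D²(A∘expChart 1)(0)(X′h, t) = 0`
for `t ∈ ker DΨ(0)` (N12 ★★★`lagrangeHessian_fderiv_apply_eq_zero` at the flat background, `λ₀ = 0` by ✓`fderiv_wilsonAction4_expChart_one_eq_zero`); (ii) `DΨ(0)(X′h) = D datum(0) h`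
(✓`hasFDerivAt_constraint_comp`); (iii) the ENTRY derivative of `g ↦ expChart 1 (X g)` at `0` is the entry array of `X′h` (`hasFDerivAt_coe_expChart_one`). [cite: Balaban1985Variational, (82)–(83) p.290, (176)–(178) p.306, (36) p.283; Balaban1989LargeFieldII, (1.12) p.359] -/
theorem flatCritical_tangentData {P : Params} {V G : Type*} [NormedAddCommGroup V] [NormedSpace ℝ V] [FiniteDimensional ℝ V]
    [NormedAddCommGroup G] [NormedSpace ℝ G]
    {Ψ : (PBond P 0 → lieSU (Fin 2)) → V} {X : G → PBond P 0 → lieSU (Fin 2)} (hX₀ : X 0 = 0)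
    {X' : G →L[ℝ] PBond P 0 → lieSU (Fin 2)} (hX : HasFDerivAt X X' 0) (hΨd : DifferentiableAt ℝ Ψ 0)
    {Ψ₂ : (PBond P 0 → lieSU (Fin 2)) →L[ℝ] (PBond P 0 → lieSU (Fin 2)) →L[ℝ] V} (hΨ₂ : HasFDerivAt (fun Y => fderiv ℝ Ψ Y) Ψ₂ 0)
    (hsurj : Function.Surjective (fderiv ℝ Ψ 0))
    (hcrit : ∀ᶠ g in 𝓝 (0 : G), ∀ t, fderiv ℝ Ψ (X g) t = 0 →
      fderiv ℝ (fun Y : PBond P 0 → lieSU (Fin 2) => wilsonAction4 (expChart (1 : GaugeField P 0 (SU 2)) Y)) (X g) t = 0)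
    {datum : G → V} (hfib : ∀ᶠ g in 𝓝 (0 : G), Ψ (X g) = datum g) :
    (∀ (h : G) (t : PBond P 0 → lieSU (Fin 2)), fderiv ℝ Ψ 0 t = 0 →
        fderiv ℝ (fun Y => fderiv ℝ (fun Y : PBond P 0 → lieSU (Fin 2) => wilsonAction4 (expChart (1 : GaugeField P 0 (SU 2)) Y)) Y) 0 (X' h) t = 0) ∧
      (∀ h : G, fderiv ℝ Ψ 0 (X' h) = fderiv ℝ datum 0 h) ∧
      (∀ (h : G) (b : PBond P 0) (i i' : Fin 2),
        fderiv ℝ (fun g : G => fun (b : PBond P 0) (i i' : Fin 2) =>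
            ((expChart (1 : GaugeField P 0 (SU 2)) (X g) b : SU 2) : Matrix (Fin 2) (Fin 2) ℂ) i i') 0 h b i i' =
          ((X' h b : lieSU (Fin 2)) : Matrix (Fin 2) (Fin 2) ℂ) i i') := by
  refine ⟨fun h t ht => ?_, fun h => ?_, fun h b i i' => ?_⟩
  · have key := lagrangeHessian_fderiv_apply_eq_zero hX₀ hX (hasFDerivAt_fderiv_wilsonAction4_expChart (1 : GaugeField P 0 (SU 2)) 0) hΨ₂ hsurj
      (lagrangeForm_zero_of_fderiv_eq_zero Ψ fderiv_wilsonAction4_expChart_one_eq_zero) hcrit h ht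
    rw [zero_apply, sub_zero] at key
    exact key
  · have hc := hasFDerivAt_constraint_comp hX₀ hX hΨd
    have hd : HasFDerivAt datum ((fderiv ℝ Ψ 0).comp X') 0 := hc.congr_of_eventuallyEq (hfib.mono fun g hg => hg.symm)
    rw [hd.fderiv, ContinuousLinearMap.comp_apply]
  · have hE : HasFDerivAt (fun Y : PBond P 0 → lieSU (Fin 2) =>
          fun b : PBond P 0 => ((expChart (1 : GaugeField P 0 (SU 2)) Y b : SU 2) : Matrix (Fin 2) (Fin 2) ℂ))
        (ContinuousLinearMap.pi fun b : PBond P 0 => (lieSU (Fin 2)).subtypeL.comp (ContinuousLinearMap.proj b)) (X 0) := by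
      rw [hX₀]; exact hasFDerivAt_coe_expChart_one
    have hM : HasFDerivAt (fun g : G => fun b : PBond P 0 => ((expChart (1 : GaugeField P 0 (SU 2)) (X g) b : SU 2) : MatA 2))
        ((ContinuousLinearMap.pi fun b : PBond P 0 => (lieSU (Fin 2)).subtypeL.comp (ContinuousLinearMap.proj b)).comp X') 0 :=
      hE.comp (0 : G) hX
    rw [fderiv_entries_apply (fun g : G => fun b : PBond P 0 => ((expChart (1 : GaugeField P 0 (SU 2)) (X g) b : SU 2) : MatA 2)) hM h b i i']
    rfl

/-- **THE FLAT TANGENT-CRITICAL EXP-CHART FAMILY token** (Node00 side, DISPLAYED — asserts nothing): the chart `B ↦ expChart 1 (X B)` passes through `1`, is differentiable at `0`,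
its members are tangent-critical on their fibres for the `C²` constraint chart `Ψ` (onto `DΨ(0)`) near `B = 0`, and they lie on the fibres over `datum B`.  Suppliers: KNIT (rng)∕(min) +
✓`Node00.isCritOnFibre_of_isMinimizer_class6` + ✓`fderiv_wilsonAction4_expChart_apply_eq_zero_of_isCritOnFibre`; ONTO-at-flat of the linearised `(k+1)`-fold averaging; def-Y §5.
[cite: Balaban1985Variational, Thm 1 p.279, (82)–(83) p.290, Prop. 9 p.309; Balaban1988Convergent, (2.12) p.256] -/
def FlatCriticalExpChartFamilyAt (k K : ℕ) {V : Type*} [NormedAddCommGroup V] [NormedSpace ℝ V]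
    (X : (Fin (F.P K).d → Site (F.P K) (k + 1) → θ.Vβ) → PBond (F.P K) 0 → lieSU (Fin 2))
    (Ψ : (PBond (F.P K) 0 → lieSU (Fin 2)) → V) (datum : (Fin (F.P K).d → Site (F.P K) (k + 1) → θ.Vβ) → V) : Prop :=
  letI := θ.instVβ₁; letI := θ.instVβ₂
  X 0 = 0 ∧ DifferentiableAt ℝ X 0 ∧ DifferentiableAt ℝ Ψ 0 ∧ DifferentiableAt ℝ (fun Y => fderiv ℝ Ψ Y) 0 ∧
    Function.Surjective (fderiv ℝ Ψ 0) ∧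
    (∀ᶠ B in 𝓝 (0 : Fin (F.P K).d → Site (F.P K) (k + 1) → θ.Vβ), ∀ t, fderiv ℝ Ψ (X B) t = 0 →
      fderiv ℝ (fun Y : PBond (F.P K) 0 → lieSU (Fin 2) => wilsonAction4 (expChart (1 : GaugeField (F.P K) 0 (SU 2)) Y)) (X B) t = 0) ∧
    (∀ᶠ B in 𝓝 (0 : Fin (F.P K).d → Site (F.P K) (k + 1) → θ.Vβ), Ψ (X B) = datum B)

/-- **(J-crit′) THE FLAT CRITICALITY DICTIONARY** (DISPLAYED — asserts nothing; a finite normalisation identity between DEF-1's K0 quadratic form `⟪dcE 1 ·, dcE 1 ·⟫` on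
`ξ⁻¹`·re∕im ENTRIES and Node00's second variation `D²(A∘expChart 1)(0)` on `𝔰𝔲(2)`-fields): every K0 test pairing against `w ∈ ker Q` is realised as `D²(A∘expChart 1)(0)(·, t)` for some
`t ∈ ker DΨ(0)`. [cite: Balaban1985Variational, (82)–(83) p.290, (37) p.283; Balaban1984PropagatorsI, (1.65)–(1.66) p.33] -/
def FlatCritDictionary (k K : ℕ) {V : Type*} [NormedAddCommGroup V] [NormedSpace ℝ V] (Ψ : (PBond (F.P K) 0 → lieSU (Fin 2)) → V) : Prop :=
  ∀ hk : k + 1 ≤ (F.P K).m + (F.P K).K, ∀ (i i' : Fin 2) (w : BondSpace (F.P K)), QE (univDomains F k K hk) w = 0 →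
    (∃ t, fderiv ℝ Ψ 0 t = 0 ∧ ∀ Y : PBond (F.P K) 0 → lieSU (Fin 2),
      ⟪dcE 1 (reBond F K fun b => (((F.P K).eta (k + 1))⁻¹ : ℂ) * ((Y b : lieSU (Fin 2)) : Matrix (Fin 2) (Fin 2) ℂ) i i'), dcE 1 w⟫_ℝ =
        fderiv ℝ (fun Y => fderiv ℝ (fun Y : PBond (F.P K) 0 → lieSU (Fin 2) => wilsonAction4 (expChart (1 : GaugeField (F.P K) 0 (SU 2)) Y)) Y) 0 Y t) ∧
    (∃ t, fderiv ℝ Ψ 0 t = 0 ∧ ∀ Y : PBond (F.P K) 0 → lieSU (Fin 2),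
      ⟪dcE 1 (imBond F K fun b => (((F.P K).eta (k + 1))⁻¹ : ℂ) * ((Y b : lieSU (Fin 2)) : Matrix (Fin 2) (Fin 2) ℂ) i i'), dcE 1 w⟫_ℝ =
        fderiv ℝ (fun Y => fderiv ℝ (fun Y : PBond (F.P K) 0 → lieSU (Fin 2) => wilsonAction4 (expChart (1 : GaugeField (F.P K) 0 (SU 2)) Y)) Y) 0 Y t)

/-- **(J-cons′) THE FLAT CONSTRAINT DICTIONARY** (DISPLAYED — asserts nothing; the junction `qLin 1 = family Q` ✓`Node00.LinearisedAveragingFlat.qLin_one_eq_family` read in DEF-1's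
letters): a Lie-algebra field whose linearised average is the datum velocity of `respDir a l` has K0-constraint `QE(univDomains)` of its `ξ⁻¹`·re∕im entries equal to the
`ρ₈(bV a)_{ii′}`-multiple of `windowSrc l`. [cite: Balaban1985Variational, (36) p.283, (174) p.305; Balaban1987RG1, (4.35) p.290] -/
def FlatConsDictionary (k K : ℕ) {V : Type*} [NormedAddCommGroup V] [NormedSpace ℝ V] (Ψ : (PBond (F.P K) 0 → lieSU (Fin 2)) → V)
    (datum : (Fin (F.P K).d → Site (F.P K) (k + 1) → θ.Vβ) → V) : Prop :=
  letI := θ.instVβ₁; letI := θ.instVβ₂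
  ∀ hk : k + 1 ≤ (F.P K).m + (F.P K).K, ∀ (a : θ.ιβ) (l : RespLabel F k K) (i i' : Fin 2) (Y : PBond (F.P K) 0 → lieSU (Fin 2)),
    fderiv ℝ Ψ 0 Y = fderiv ℝ datum 0 (respDir F θ k K a l) →
    QE (univDomains F k K hk) (reBond F K fun b => (((F.P K).eta (k + 1))⁻¹ : ℂ) * ((Y b : lieSU (Fin 2)) : Matrix (Fin 2) (Fin 2) ℂ) i i') =
        (θ.ρ8 (θ.bV a) i i').re • windowSrc F k K hk Finset.univ l ∧
      QE (univDomains F k K hk) (imBond F K fun b => (((F.P K).eta (k + 1))⁻¹ : ℂ) * ((Y b : lieSU (Fin 2)) : Matrix (Fin 2) (Fin 2) ℂ) i i') =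
        (θ.ρ8 (θ.bV a) i i').im • windowSrc F k K hk Finset.univ l

/-- ★★★ **THE SOCKET, PLUGGED**: a flat tangent-critical exp-chart family + the two flat dictionaries ⟹ `ChartResponseWeaklyCriticalAt` for the chart `B ↦ expChart 1 (X B)` — hence, with
§2–§3 (`rootedReceipts_of_chart` under the factorisation letter), the four (R-a) receipts of the ROOTED table.  The only inputs with content are the family token's criticality ∕ fibre
clauses ([15] Thm 1 + (82)–(83)) and the two finite dictionaries; N12's machine does the rest. [cite: Balaban1985Variational, (176)–(178) p.306, (82)–(83) p.290, (36)–(37) p.283; Balaban1984PropagatorsII, (2.35) p.228; Balaban1989LargeFieldII, (1.12) p.359] -/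
theorem chartResponseWeaklyCritical_of_flatCriticalExpChartFamily (k K : ℕ) {V : Type*} [NormedAddCommGroup V] [NormedSpace ℝ V] [FiniteDimensional ℝ V]
    (X : (Fin (F.P K).d → Site (F.P K) (k + 1) → θ.Vβ) → PBond (F.P K) 0 → lieSU (Fin 2))
    (Ψ : (PBond (F.P K) 0 → lieSU (Fin 2)) → V) (datum : (Fin (F.P K).d → Site (F.P K) (k + 1) → θ.Vβ) → V)
    (hfam : FlatCriticalExpChartFamilyAt F θ k K X Ψ datum) (Jcrit : FlatCritDictionary F k K Ψ) (Jcons : FlatConsDictionary F θ k K Ψ datum)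
    (a : θ.ιβ) (l : RespLabel F k K) :
    ChartResponseWeaklyCriticalAt F θ k K (fun B => expChart (1 : GaugeField (F.P K) 0 (SU 2)) (X B)) a l := by
  letI := θ.instVβ₁; letI := θ.instVβ₂
  obtain ⟨hX₀, hXd, hΨd, hΨ₂d, hsurj, hcrit, hfib⟩ := hfam
  obtain ⟨h1, h2, h3⟩ := flatCritical_tangentData (P := F.P K) hX₀ hXd.hasFDerivAt hΨd hΨ₂d.hasFDerivAt hsurj hcrit hfib
  refine chartResponseWeaklyCritical_of_tangentData F θ k K (fun B => expChart (1 : GaugeField (F.P K) 0 (SU 2)) (X B))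
    (fun (Y : PBond (F.P K) 0 → lieSU (Fin 2)) (b : PBond (F.P K) 0) (i i' : Fin 2) => ((Y b : lieSU (Fin 2)) : Matrix (Fin 2) (Fin 2) ℂ) i i')
    (fun v => fderiv ℝ X 0 v) (fun a l b i i' => ?_) (fderiv ℝ Ψ 0)
    (fderiv ℝ (fun Y => fderiv ℝ (fun Y : PBond (F.P K) 0 → lieSU (Fin 2) => wilsonAction4 (expChart (1 : GaugeField (F.P K) 0 (SU 2)) Y)) Y) 0)
    (fun v => fderiv ℝ datum 0 v) (fun v t ht => h1 v t ht) (fun v => h2 v) Jcrit Jcons a l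
  exact (chartRespD_eq_fderiv_respDir F θ k K _ a l b i i').trans (h3 _ b i i')

/-!
APPEND NOTE (porter ▶ PTC-1 g4, 2026-08-31, INTENT-57 = whole-file re-proposal of ✓p821567 under the append protocol): everything ABOVE this block is the accepted tree file 913f045d81455be5
byte-identical (= ◇ lens-1 g11 `LENS-1g11-TangentSocket-v1.lean` 8a2b1113 + landing paragraph); BELOW: the one `open B15DeterminingSets (…)` line and §4b VERBATIM from ◇ lens-1 g11's v2
`nodeO-cover/LENS-1g11-TangentSocket-v2.lean` sha16 8724b64751b22059 · 356 l. (:256–:350; v1 ⊂ v2 verbatim otherwise — the v2 header's extra bullet is reproduced here instead of editing the module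
header: «§4b OF-RECORD EDITION (gauge-natural inputs): ★★ `flatCritical_tangentData_of_isCritOnFibre` — the criticality input in n07-e's CURVE form `Node00.IsCritOnFibre F 2 K 𝐁 (W g) (expChart 1
(X g))` (⟸ «(2.12)-minimal over the class (6)» by ✓`Node00.isCritOnFibre_of_isMinimizer_class6`) + n07-e's submersion letter at every member, via N12 §3
✓`fderiv_wilsonAction4_expChart_apply_eq_zero_of_isCritOnFibre`; displayed letter `FlatCritOnFibreExpChartFamilyAt` (of-record family token), `flatCriticalExpChartFamilyAt_of_critOnFibre`, ★★★
`chartResponseWeaklyCritical_of_critOnFibreFamily` (of-record token + (J-crit′) + (J-cons′) ⟹ `ChartResponseWeaklyCriticalAt`, all `a l`)»); the v2 posting (nodeO STATUS 11:24:06Z) crossed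
INTENT-56's filing (11:22:39Z) by 87 s.  ◆ CRIT-1 g37's cut of §4b: J1′ ∕ J4 ∕ J5′ ∕ (Q-ord) ∕ (Q-bridge) STAMP PASS; SAME-WALL verdict unchanged (SURVIVES, priced) — §4b moves the criticality
input to n07-e's CURVE form on CONFIGURATIONS, the gauge-natural predicate of record; INTENT-57 GO as the APPEND edition (< 400 l.); axioms standard on ◆'s v3scratch run (nodeO STATUS
2026-08-31T11:28:21Z).  `--supports stmt-QuantumFields-27238 --as helper` (NO `--workitem`).  HONEST (porter): calculus + logic; CONDITIONAL over DISPLAYED letters inhabited nowhere; nothing of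
Bałaban asserted, ported, discharged or refuted; (C-tab-opt) STRUCK; K0ᴬ stmt-QuantumFields-27238 ∕ K0⁷ 20541 OPEN — nothing of them proved; NODE O 0∕1; COUNT 8∕28 · K 1∕4 UNMOVED; finite 𝕋⁴ at
fixed ε — NOT continuum ∕ OS ∕ Clay; the Yang–Mills mass gap is NOT proved by any of this.
-/

open B15DeterminingSets (DetSet MSField AgreeOn avgFamily)

/-! ### §4b  The OF-RECORD edition: criticality in n07-e's CURVE form `Node00.IsCritOnFibre` (⟸ «(2.12)-minimal over the class (6)», ✓`isCritOnFibre_of_isMinimizer_class6`) -/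

/-- ★★ **THE NODE00 PLUG, OF-RECORD EDITION** — the criticality input in n07-e's CURVE form `Node00.IsCritOnFibre` (print's «critical configuration of (5) on the fibre
𝔅(𝐁, W)»; obtained from «(2.12)-minimal over the class (6)» by ✓`Node00.isCritOnFibre_of_isMinimizer_class6`) at every member `expChart 1 (X g)`, `g` near `0`, together with
n07-e's submersion letter at every member (strict derivative of `Ψ` onto; the level set of `Ψ` through `X g` mapped by `expChart 1` into the fibre `𝔅(𝐁, W g)`): N12 §3
✓`fderiv_wilsonAction4_expChart_apply_eq_zero_of_isCritOnFibre` converts them into the tangent form and `flatCritical_tangentData` applies.  GAUGE-NATURAL: `IsCritOnFibre` and the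
fibres are stated on configurations, not on chart coordinates. [cite: Balaban1985Variational, (5)–(6) p.278, (82)–(83) p.290, Prop. 8 p.304; Balaban1988Convergent, (2.10)–(2.12) p.256] -/
theorem flatCritical_tangentData_of_isCritOnFibre {K : ℕ} {𝔹 : DetSet (F.P K)} {V G : Type*} [NormedAddCommGroup V] [NormedSpace ℝ V]
    [FiniteDimensional ℝ V] [NormedAddCommGroup G] [NormedSpace ℝ G] {W : G → MSField (F.P K) (SU 2)}
    {Ψ : (PBond (F.P K) 0 → lieSU (Fin 2)) → V} {X : G → PBond (F.P K) 0 → lieSU (Fin 2)} (hX₀ : X 0 = 0)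
    {X' : G →L[ℝ] PBond (F.P K) 0 → lieSU (Fin 2)} (hX : HasFDerivAt X X' 0)
    {Ψ₂ : (PBond (F.P K) 0 → lieSU (Fin 2)) →L[ℝ] (PBond (F.P K) 0 → lieSU (Fin 2)) →L[ℝ] V} (hΨ₂ : HasFDerivAt (fun Y => fderiv ℝ Ψ Y) Ψ₂ 0)
    (hco : ∀ᶠ g in 𝓝 (0 : G), IsCritOnFibre F 2 K 𝔹 (W g) (expChart (1 : GaugeField (F.P K) 0 (SU 2)) (X g)))
    (hchart : ∀ᶠ g in 𝓝 (0 : G), HasStrictFDerivAt Ψ (fderiv ℝ Ψ (X g)) (X g) ∧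
      ((fderiv ℝ Ψ (X g) : (PBond (F.P K) 0 → lieSU (Fin 2)) →ₗ[ℝ] V).range = ⊤) ∧
      ∀ Y, Ψ Y = Ψ (X g) → AgreeOn 𝔹 (avgFamily (avOfRecord F 2 K) (expChart (1 : GaugeField (F.P K) 0 (SU 2)) Y)) (W g))
    {datum : G → V} (hfib : ∀ᶠ g in 𝓝 (0 : G), Ψ (X g) = datum g) :
    (∀ (h : G) (t : PBond (F.P K) 0 → lieSU (Fin 2)), fderiv ℝ Ψ 0 t = 0 →
        fderiv ℝ (fun Y => fderiv ℝ (fun Y : PBond (F.P K) 0 → lieSU (Fin 2) =>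
          wilsonAction4 (expChart (1 : GaugeField (F.P K) 0 (SU 2)) Y)) Y) 0 (X' h) t = 0) ∧
      (∀ h : G, fderiv ℝ Ψ 0 (X' h) = fderiv ℝ datum 0 h) ∧
      (∀ (h : G) (b : PBond (F.P K) 0) (i i' : Fin 2),
        fderiv ℝ (fun g : G => fun (b : PBond (F.P K) 0) (i i' : Fin 2) =>
            ((expChart (1 : GaugeField (F.P K) 0 (SU 2)) (X g) b : SU 2) : Matrix (Fin 2) (Fin 2) ℂ) i i') 0 h b i i' =
          ((X' h b : lieSU (Fin 2)) : Matrix (Fin 2) (Fin 2) ℂ) i i') := by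
  have hΨd : DifferentiableAt ℝ Ψ 0 := by
    have h0 := (hchart.self_of_nhds).1
    rw [hX₀] at h0
    exact h0.hasFDerivAt.differentiableAt
  have hsurj : Function.Surjective (fderiv ℝ Ψ 0) := by
    have hr := (hchart.self_of_nhds).2.1
    rw [hX₀] at hr
    intro y
    have hy : y ∈ ((fderiv ℝ Ψ 0 : (PBond (F.P K) 0 → lieSU (Fin 2)) →ₗ[ℝ] V)).range := by rw [hr]; trivial
    obtain ⟨x, hx⟩ := hy
    exact ⟨x, hx⟩
  have hcrit : ∀ᶠ g in 𝓝 (0 : G), ∀ t, fderiv ℝ Ψ (X g) t = 0 →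
      fderiv ℝ (fun Y : PBond (F.P K) 0 → lieSU (Fin 2) => wilsonAction4 (expChart (1 : GaugeField (F.P K) 0 (SU 2)) Y)) (X g) t = 0 := by
    filter_upwards [hco, hchart] with g hm hc t ht
    exact fderiv_wilsonAction4_expChart_apply_eq_zero_of_isCritOnFibre (1 : GaugeField (F.P K) 0 (SU 2)) hc.1 hc.2.1 hc.2.2 hm ht
  exact flatCritical_tangentData hX₀ hX hΨd hΨ₂ hsurj hcrit hfib

/-- **THE FLAT CRITICAL-ON-FIBRE EXP-CHART FAMILY token, OF-RECORD EDITION** (DISPLAYED — asserts nothing): as `FlatCriticalExpChartFamilyAt`, with the criticality clause in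
n07-e's CURVE form `Node00.IsCritOnFibre F 2 K 𝐁 (W B) (expChart 1 (X B))` (⟸ (2.12)-minimality over the class (6), ✓`isCritOnFibre_of_isMinimizer_class6`) and n07-e's submersion
letter at every member near `B = 0`. [cite: Balaban1985Variational, Thm 1 p.279, (5)–(6) p.278, (82)–(83) p.290, Prop. 8 p.304; Balaban1988Convergent, (2.10)–(2.12) p.256] -/
def FlatCritOnFibreExpChartFamilyAt (k K : ℕ) {V : Type*} [NormedAddCommGroup V] [NormedSpace ℝ V] (𝔹 : DetSet (F.P K))
    (W : (Fin (F.P K).d → Site (F.P K) (k + 1) → θ.Vβ) → MSField (F.P K) (SU 2))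
    (X : (Fin (F.P K).d → Site (F.P K) (k + 1) → θ.Vβ) → PBond (F.P K) 0 → lieSU (Fin 2))
    (Ψ : (PBond (F.P K) 0 → lieSU (Fin 2)) → V) (datum : (Fin (F.P K).d → Site (F.P K) (k + 1) → θ.Vβ) → V) : Prop :=
  letI := θ.instVβ₁; letI := θ.instVβ₂
  X 0 = 0 ∧ DifferentiableAt ℝ X 0 ∧ DifferentiableAt ℝ (fun Y => fderiv ℝ Ψ Y) 0 ∧
    (∀ᶠ B in 𝓝 (0 : Fin (F.P K).d → Site (F.P K) (k + 1) → θ.Vβ),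
      IsCritOnFibre F 2 K 𝔹 (W B) (expChart (1 : GaugeField (F.P K) 0 (SU 2)) (X B))) ∧
    (∀ᶠ B in 𝓝 (0 : Fin (F.P K).d → Site (F.P K) (k + 1) → θ.Vβ),
      HasStrictFDerivAt Ψ (fderiv ℝ Ψ (X B)) (X B) ∧
        ((fderiv ℝ Ψ (X B) : (PBond (F.P K) 0 → lieSU (Fin 2)) →ₗ[ℝ] V).range = ⊤) ∧
        ∀ Y, Ψ Y = Ψ (X B) → AgreeOn 𝔹 (avgFamily (avOfRecord F 2 K) (expChart (1 : GaugeField (F.P K) 0 (SU 2)) Y)) (W B)) ∧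
    (∀ᶠ B in 𝓝 (0 : Fin (F.P K).d → Site (F.P K) (k + 1) → θ.Vβ), Ψ (X B) = datum B)

/-- The of-record token implies the tangent-form token (N12 §3 + «onto at `0`» read off the submersion letter at `B = 0`). [cite: Balaban1985Variational, (82)–(83) p.290] -/
theorem flatCriticalExpChartFamilyAt_of_critOnFibre (k K : ℕ) {V : Type*} [NormedAddCommGroup V] [NormedSpace ℝ V] [FiniteDimensional ℝ V]
    {𝔹 : DetSet (F.P K)} {W : (Fin (F.P K).d → Site (F.P K) (k + 1) → θ.Vβ) → MSField (F.P K) (SU 2)}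
    {X : (Fin (F.P K).d → Site (F.P K) (k + 1) → θ.Vβ) → PBond (F.P K) 0 → lieSU (Fin 2)}
    {Ψ : (PBond (F.P K) 0 → lieSU (Fin 2)) → V} {datum : (Fin (F.P K).d → Site (F.P K) (k + 1) → θ.Vβ) → V}
    (h : FlatCritOnFibreExpChartFamilyAt F θ k K 𝔹 W X Ψ datum) : FlatCriticalExpChartFamilyAt F θ k K X Ψ datum := by
  letI := θ.instVβ₁; letI := θ.instVβ₂
  obtain ⟨hX₀, hXd, hΨ₂d, hco, hchart, hfib⟩ := h
  have h0 := (hchart.self_of_nhds).1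
  have hr := (hchart.self_of_nhds).2.1
  rw [hX₀] at h0 hr
  have hΨd : DifferentiableAt ℝ Ψ 0 := h0.hasFDerivAt.differentiableAt
  have hsurj : Function.Surjective (fderiv ℝ Ψ 0) := by
    intro y
    have hy : y ∈ ((fderiv ℝ Ψ 0 : (PBond (F.P K) 0 → lieSU (Fin 2)) →ₗ[ℝ] V)).range := by rw [hr]; trivial
    obtain ⟨x, hx⟩ := hy
    exact ⟨x, hx⟩
  have hcrit : ∀ᶠ B in 𝓝 (0 : Fin (F.P K).d → Site (F.P K) (k + 1) → θ.Vβ), ∀ t, fderiv ℝ Ψ (X B) t = 0 →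
      fderiv ℝ (fun Y : PBond (F.P K) 0 → lieSU (Fin 2) => wilsonAction4 (expChart (1 : GaugeField (F.P K) 0 (SU 2)) Y)) (X B) t = 0 := by
    filter_upwards [hco, hchart] with g hm hc t ht
    exact fderiv_wilsonAction4_expChart_apply_eq_zero_of_isCritOnFibre (1 : GaugeField (F.P K) 0 (SU 2)) hc.1 hc.2.1 hc.2.2 hm ht
  exact ⟨hX₀, hXd, hΨd, hΨ₂d, hsurj, hcrit, hfib⟩

/-- ★★★ **THE SOCKET, PLUGGED AT THE PREDICATES OF RECORD**: a family of chart points whose members `expChart 1 (X B)` are CRITICAL ON THEIR FIBRES in n07-e's curve form (⟸ (2.12)-minimal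
over the class (6)) with n07-e's submersion letter, + the two flat dictionaries ⟹ `ChartResponseWeaklyCriticalAt` for `B ↦ expChart 1 (X B)`, all `a l`.
[cite: Balaban1985Variational, (176)–(178) p.306, (82)–(83) p.290, Prop. 8 p.304; Balaban1984PropagatorsII, (2.35) p.228; Balaban1988Convergent, (2.12) p.256] -/
theorem chartResponseWeaklyCritical_of_critOnFibreFamily (k K : ℕ) {V : Type*} [NormedAddCommGroup V] [NormedSpace ℝ V] [FiniteDimensional ℝ V]
    (𝔹 : DetSet (F.P K)) (W : (Fin (F.P K).d → Site (F.P K) (k + 1) → θ.Vβ) → MSField (F.P K) (SU 2))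
    (X : (Fin (F.P K).d → Site (F.P K) (k + 1) → θ.Vβ) → PBond (F.P K) 0 → lieSU (Fin 2))
    (Ψ : (PBond (F.P K) 0 → lieSU (Fin 2)) → V) (datum : (Fin (F.P K).d → Site (F.P K) (k + 1) → θ.Vβ) → V)
    (hfam : FlatCritOnFibreExpChartFamilyAt F θ k K 𝔹 W X Ψ datum) (Jcrit : FlatCritDictionary F k K Ψ) (Jcons : FlatConsDictionary F θ k K Ψ datum)
    (a : θ.ιβ) (l : RespLabel F k K) :
    ChartResponseWeaklyCriticalAt F θ k K (fun B => expChart (1 : GaugeField (F.P K) 0 (SU 2)) (X B)) a l :=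
  chartResponseWeaklyCritical_of_flatCriticalExpChartFamily F θ k K X Ψ datum
    (flatCriticalExpChartFamilyAt_of_critOnFibre F θ k K hfam) Jcrit Jcons a l

end TangentSocket

end Summit.QuantumFields.YangMills.Theorems.K0AxCtabUniq

end
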